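import Summits.Ventures.CertifiedQuantumChemistry.Rows.StrongCouplingDoublonBound
import Summits.Ventures.CertifiedQuantumChemistry.Rows.FrozenCoreRelaxationParticleHole
import HarnessLib

/-!
# Ventures/CertifiedQuantumChemistry — Rows/StrongCouplingEntryBounds.lean: CLAIM N step (1), THE
# ENTRY-CLASS MECHANISMS on every DQG-feasible pair — `D` / `Q` / `G` border and corner entries against
# small diagonals, and the connected-`G` CHARGE IDENTITY `w_p†(G − γγ†)w_p = d_p + e_p − (n_p − 1)²`

HONEST FRAMING (verbatim): certified bounds for a stated model Hamiltonian in a stated basis; not a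
claim about the real molecule beyond that model. Nothing here is a state, a row, a claim node or a
value of record; the statements are about ARBITRARY feasible pairs of the abstract `D, Q, G`
programme (`IsDQGFeasible`; nothing about a model or a file).

Seat rdm-B (gen 36), zero compute; theorems only (no `def`). Third file of the step-(1) set after
`Rows/StrongCouplingBookkeeping.lean` (gen 21: the hop bound `‖γ_{iσ,jσ}‖ ≤ √d_i + √e_i`, `Σ e = Σ d`
at half filling) and `Rows/StrongCouplingDoublonBound.lean` (+ `Rows/HubbardRingTVDoublonBound.lean`,
gen 35: the doublon BUDGET `s := Σ_p Re d_p ≤ (4τ|Λ|^{3/2}/U)²` for every feasible pair of a half-filled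
Hubbard-type table with `Re E ≤ Re E_core`, `U > 0`; unconditionally for the TV-H optimal pair).
CLAIM N (HOME/INBOX L765 (ii); `STRUCTURE.md` §2.2.13 (ii)) step (1) says, in words, that this budget
makes "EVERY scaled variable bounded along the sequence (`Δ_ii, Ε_ii ≤ C²`, hops`/ε ≤ 2C`; inside any
PSD block `|B_{rJ}|² ≤ B_{rr}B_{JJ}` bounds every border entry `/ε` … and every `J–J′` entry `/ε²`;
`Ĝ ⪰ 0` on the DQG-feasible set with `w_iᵀĜw_i = d_i + e_i = O(ε²)` bounds `u_i` and `κ_{ii′}`)". This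
file TYPES the two MECHANISMS of that list which the earlier files do not have, valid on every
DQG-feasible pair (`d_p := Γ_{(p↑,p↓),(p↑,p↓)}`, `e_p := ²Q_{(p↑,p↓),(p↑,p↓)}`,
`n_p := γ_{p↑,p↑} + γ_{p↓,p↓}`, `ε = 1/U`); the sibling `Rows/StrongCouplingBudgetBounds.lean` (same
gen) then lets the budget control every class and instantiates the TV-H files:

* §1 `norm_form_le_sqrt_of_posSemidef` — Cauchy–Schwarz for the sesquilinear form of a complex PSD
  matrix, `‖x† M y‖ ≤ √(Re x†Mx · Re y†My)` (the `2 × 2` compression `[x y]† M [x y] ⪰ 0` fed to the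
  bookkeeping file's entry bound `norm_apply_le_sqrt_of_posSemidef`).
* §2 INSIDE ANY PSD BLOCK (every `IsDQGFeasible N γ Γ`, any orbital index type): `‖Γ_{rJ}‖ ≤ √(Re Γ_{JJ})`
  and `‖Γ_{JJ′}‖ ≤ √(Re Γ_{JJ})·√(Re Γ_{J′J′})` (`D`; diagonal `≤ 1` by the Weinhold–Wilson file's
  `pairDiag_le_one`), the same for `²Q = qMap γ Γ` and `²G = gMap γ Γ` (`qMap_diag_re_mem`,
  `gMap_diag_re_mem`) — border entries are `O(ε)` and corner entries `O(ε²)` as soon as the corner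
  DIAGONAL is `O(ε²)` (a doubly occupied pair index `J = (p↑,p↓)`: `Γ_{JJ} = d_p`, `²Q_{JJ} = e_p`).
* §3 THE CONNECTED PARTICLE-HOLE MATRIX `Ĝ := G − γγ†` (`⪰ 0` on the DQG-feasible set:
  `gMap_sub_vecMulVec_posSemidef`, `Rows/FrozenCoreRelaxationParticleHole.lean`, reused) AT THE CHARGE
  VECTOR `w_p := e_(p↑,p↑) + e_(p↓,p↓)`: the EXACT identity **`w_p†Ĝw_p = d_p + e_p − (n_p − 1)²`**
  (`chargeForm_gHat_eq`; the words' "`= d_i + e_i`" is the case `n_p = 1`, which holds on the files by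
  translation invariance but is not a row of the programme), hence `0 ≤ Re w_p†Ĝw_p ≤ Re d_p + Re e_p`
  AND **`(Re n_p − 1)² ≤ Re d_p + Re e_p`** (`sq_occupation_sub_one_le`: LOCAL half filling is forced
  to `O(ε)` by `Ĝ ⪰ 0` alone, site by site, on every feasible pair); the `Ĝ`-Cauchy–Schwarz
  consequences `‖x†Ĝw_p‖ ≤ √(Re x†Ĝx)·√(Re d_p + Re e_p)` (charge-moment entries, the words' `u_i`)
  and `‖w_p†Ĝw_q‖ ≤ √(Re d_p + Re e_p)·√(Re d_q + Re e_q)` (connected density–density entries, the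
  words' `κ_{ii′}`).

What this file is NOT: the identification of these finite-`U` entries with the NAMED variables of the
emitted limit programme `X_∞¹FS(L, X)` (`Δ`, `Ε`, `bD`, `bQ`, `u`, `κ`, …) — that needs the `X_∞`
programme as a Lean object, a definition item nobody has filed; steps (2)–(4) are typed abstractly in
`Rows/ClaimNAnalyticStep.lean`. Everything is PROVED (0 sorry), standard axioms; no definitions, no
named facts; no claim node, hint, row or CERTIFIED cell depends on it. References (docstring-only):
D. A. Mazziotti, Adv. Chem. Phys. 134 (2007) ch. 3 §II.B (the `D, Q, G` maps); R. A. Horn,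
C. R. Johnson, *Matrix Analysis* (2013) §7.1 (principal minors, Cauchy–Schwarz for PSD forms);
B. Verstichel et al., Phys. Rev. Lett. 108 (2012) 213001 (doublon / hop elements of the PQG optimum at
large `U`); the rest is elementary.
-/

noncomputable section

namespace Summit.Ventures.CertifiedQuantumChemistry

open Matrix Finset
open Literature.MathematicalPhysics.QuantumLattice Literature.MathematicalPhysics.QuantumChemistry
open scoped ComplexOrder

namespace StrongCouplingEntry

/-! ### §1 Cauchy–Schwarz for the sesquilinear form of a PSD matrix -/

section CauchySchwarz

variable {n : Type*} [Fintype n]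

/-- Entries of the two-row compression `B M Bᴴ`, `B_k = v_k†`: `(B M Bᴴ)_{ab} = v_a† M v_b`.
(plumbing) [folklore] -/
theorem compress_apply (M : Matrix n n ℂ) (v : Fin 2 → n → ℂ) (a b : Fin 2) :
    (Matrix.of (fun k i => star (v k i)) * M * (Matrix.of (fun k i => star (v k i)))ᴴ) a b
      = star (v a) ⬝ᵥ M *ᵥ v b := by
  simp only [Matrix.mul_apply, conjTranspose_apply, of_apply, star_star, dotProduct, mulVec,
    Pi.star_apply, Finset.sum_mul, Finset.mul_sum, mul_assoc]
  rw [Finset.sum_comm]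

/-- **CAUCHY–SCHWARZ FOR A PSD FORM.** For a complex positive semidefinite `M` and any vectors
`x, y`: `‖x† M y‖ ≤ √(Re x†Mx · Re y†My)` — the entry bound
`StrongCouplingBookkeeping`'s `norm_apply_le_sqrt_of_posSemidef` applied to the `2 × 2` compression
`[x y]† M [x y] ⪰ 0`. [folklore; Horn–Johnson §7.1] -/
theorem norm_form_le_sqrt_of_posSemidef {M : Matrix n n ℂ} (hM : M.PosSemidef) (x y : n → ℂ) :
    ‖star x ⬝ᵥ M *ᵥ y‖ ≤ Real.sqrt ((star x ⬝ᵥ M *ᵥ x).re * (star y ⬝ᵥ M *ᵥ y).re) := by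
  set v : Fin 2 → n → ℂ := ![x, y] with hv
  have hP : (Matrix.of (fun k i => star (v k i)) * M *
      (Matrix.of (fun k i => star (v k i)))ᴴ).PosSemidef := hM.mul_mul_conjTranspose_same _
  have h := norm_apply_le_sqrt_of_posSemidef hP 0 1
  simp only [compress_apply, hv, Matrix.cons_val_zero, Matrix.cons_val_one] at h
  exact h

end CauchySchwarz

/-! ### §2 Inside any PSD block: border and corner entries against small diagonals -/

section Blocks

variable {ι : Type*} [LinearOrder ι] [Fintype ι] {N : ℕ}
variable {γ : Matrix ι ι ℂ} {Γ : Matrix (ι × ι) (ι × ι) ℂ}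

/-- `√(a·b) ≤ √b` when `a ≤ 1` and `b ≥ 0`. (plumbing) [folklore] -/
theorem sqrt_mul_le_sqrt_of_le_one {a b : ℝ} (ha : a ≤ 1) (hb : 0 ≤ b) :
    Real.sqrt (a * b) ≤ Real.sqrt b :=
  Real.sqrt_le_sqrt (by nlinarith)

/-- **`D`-BLOCK BORDER ENTRIES**: on the DQG-feasible set `‖Γ_{rJ}‖ ≤ √(Re Γ_{JJ})` for every pair
indices `r, J` (the `2 × 2` minor of `Γ ⪰ 0` and `Re Γ_{rr} ≤ 1`, `IsDQGFeasible.pairDiag_le_one`) —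
an entry against a pair index of small diagonal (a doubly occupied site, `Γ_{JJ} = d_p = O(ε²)`) is
`O(ε)`. [folklore] -/
theorem norm_two_apply_le_sqrt_diag (hf : IsDQGFeasible N γ Γ) (r J : ι × ι) :
    ‖Γ r J‖ ≤ Real.sqrt (Γ J J).re := by
  obtain ⟨i, j⟩ := r
  exact (norm_apply_le_sqrt_of_posSemidef hf.d_psd _ J).trans
    (sqrt_mul_le_sqrt_of_le_one (hf.pairDiag_le_one i j)
      (Complex.nonneg_iff.1 (hf.d_psd.diag_nonneg (i := J))).1)

/-- **`D`-BLOCK CORNER ENTRIES**: `‖Γ_{JJ′}‖ ≤ √(Re Γ_{JJ})·√(Re Γ_{J′J′})` — an entry between two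
pair indices of `O(ε²)` diagonal is `O(ε²)`. [folklore] -/
theorem norm_two_apply_le_sqrt_mul_sqrt (hf : IsDQGFeasible N γ Γ) (J J' : ι × ι) :
    ‖Γ J J'‖ ≤ Real.sqrt (Γ J J).re * Real.sqrt (Γ J' J').re := by
  rw [← Real.sqrt_mul (Complex.nonneg_iff.1 (hf.d_psd.diag_nonneg (i := J))).1]
  exact norm_apply_le_sqrt_of_posSemidef hf.d_psd J J'

/-- **`Q`-BLOCK BORDER ENTRIES**: `‖²Q_{rJ}‖ ≤ √(Re ²Q_{JJ})` (`qMap γ Γ ⪰ 0`, `Re ²Q_{rr} ≤ 1` by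
`IsDQGFeasible.qMap_diag_re_mem`) — entries against a pair index of small HOLON weight
(`²Q_{JJ} = e_p = O(ε²)`) are `O(ε)`. [folklore] -/
theorem norm_qMap_apply_le_sqrt_diag (hf : IsDQGFeasible N γ Γ) (r J : ι × ι) :
    ‖qMap γ Γ r J‖ ≤ Real.sqrt (qMap γ Γ J J).re := by
  obtain ⟨i, j⟩ := r
  exact (norm_apply_le_sqrt_of_posSemidef hf.q_psd _ J).trans
    (sqrt_mul_le_sqrt_of_le_one (hf.qMap_diag_re_mem i j).2
      (Complex.nonneg_iff.1 (hf.q_psd.diag_nonneg (i := J))).1)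

/-- **`Q`-BLOCK CORNER ENTRIES**: `‖²Q_{JJ′}‖ ≤ √(Re ²Q_{JJ})·√(Re ²Q_{J′J′})`. [folklore] -/
theorem norm_qMap_apply_le_sqrt_mul_sqrt (hf : IsDQGFeasible N γ Γ) (J J' : ι × ι) :
    ‖qMap γ Γ J J'‖ ≤ Real.sqrt (qMap γ Γ J J).re * Real.sqrt (qMap γ Γ J' J').re := by
  rw [← Real.sqrt_mul (Complex.nonneg_iff.1 (hf.q_psd.diag_nonneg (i := J))).1]
  exact norm_apply_le_sqrt_of_posSemidef hf.q_psd J J'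

/-- **`G`-BLOCK BORDER ENTRIES**: `‖²G_{rJ}‖ ≤ √(Re ²G_{JJ})` (`gMap γ Γ ⪰ 0`, `Re ²G_{rr} ≤ 1` by
`IsDQGFeasible.gMap_diag_re_mem`). [folklore] -/
theorem norm_gMap_apply_le_sqrt_diag (hf : IsDQGFeasible N γ Γ) (r J : ι × ι) :
    ‖gMap γ Γ r J‖ ≤ Real.sqrt (gMap γ Γ J J).re := by
  obtain ⟨i, j⟩ := r
  exact (norm_apply_le_sqrt_of_posSemidef hf.g_psd _ J).trans
    (sqrt_mul_le_sqrt_of_le_one (hf.gMap_diag_re_mem i j).2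
      (Complex.nonneg_iff.1 (hf.g_psd.diag_nonneg (i := J))).1)

/-- **`G`-BLOCK CORNER ENTRIES**: `‖²G_{JJ′}‖ ≤ √(Re ²G_{JJ})·√(Re ²G_{J′J′})`. [folklore] -/
theorem norm_gMap_apply_le_sqrt_mul_sqrt (hf : IsDQGFeasible N γ Γ) (J J' : ι × ι) :
    ‖gMap γ Γ J J'‖ ≤ Real.sqrt (gMap γ Γ J J).re * Real.sqrt (gMap γ Γ J' J').re := by
  rw [← Real.sqrt_mul (Complex.nonneg_iff.1 (hf.g_psd.diag_nonneg (i := J))).1]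
  exact norm_apply_le_sqrt_of_posSemidef hf.g_psd J J'

end Blocks

/-! ### §3 The connected particle-hole matrix `Ĝ = G − γγ†` at the charge vector of a site -/

section Charge

variable {Λ : Type*} [LinearOrder Λ] [Fintype Λ] {N : ℕ}
variable {γ : Matrix (Orb Λ) (Orb Λ) ℂ} {Γ : Matrix (Orb Λ × Orb Λ) (Orb Λ × Orb Λ) ℂ}

/-- **THE `G`-FORM AT THE CHARGE VECTOR.** For an antisymmetric `Γ` and the charge vector of site
`p`, `w_p := e_(p↑,p↑) + e_(p↓,p↓)`: `w_p† (gMap γ Γ) w_p = γ_{p↑,p↑} + γ_{p↓,p↓} + 2 d_p` (for states: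
`⟨n̂_p²⟩ = ⟨n̂_p⟩ + 2⟨n̂_{p↑}n̂_{p↓}⟩`). [folklore] -/
theorem chargeForm_gMap_eq (hfst : ∀ i j q, Γ (j, i) q = -Γ (i, j) q)
    (hsnd : ∀ r k l, Γ r (l, k) = -Γ r (k, l)) (p : Λ) :
    star (Pi.single (orb p 0, orb p 0) (1 : ℂ) + Pi.single (orb p 1, orb p 1) 1) ⬝ᵥ
        gMap γ Γ *ᵥ (Pi.single (orb p 0, orb p 0) (1 : ℂ) + Pi.single (orb p 1, orb p 1) 1)
      = γ (orb p 0) (orb p 0) + γ (orb p 1) (orb p 1) + 2 * Γ (orb p 0, orb p 1) (orb p 0, orb p 1) := by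
  have h01 : orb p (0 : Fin 2) ≠ orb p 1 := fun h => absurd (orb_inj.1 h).2 (by decide)
  have h10 : orb p (1 : Fin 2) ≠ orb p 0 := fun h => absurd (orb_inj.1 h).2 (by decide)
  rw [Literature.LinearAlgebra.Matrix.star_dotProduct_mulVec_single_add_single]
  simp only [gMap_apply, star_one, one_mul, if_true, if_neg h01, if_neg h10, zero_sub]
  rw [StrongCouplingDoublon.two_apply_samePair_eq_zero hfst (orb p 0),
    StrongCouplingDoublon.two_apply_samePair_eq_zero hfst (orb p 1),
    hsnd (orb p 0, orb p 1) (orb p 0) (orb p 1), hfst (orb p 0) (orb p 1) (orb p 0, orb p 1)]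
  ring

/-- **THE RANK-ONE FORM AT THE CHARGE VECTOR**: `w_p† (γγ†) w_p = n_p · n̄_p` with
`n_p = γ_{p↑,p↑} + γ_{p↓,p↓}` (`γ` read as a pair vector `v_{(i,j)} = γ_{ij}`). [folklore] -/
theorem chargeForm_vecMulVec_eq (p : Λ) :
    star (Pi.single (orb p 0, orb p 0) (1 : ℂ) + Pi.single (orb p 1, orb p 1) 1) ⬝ᵥ
        vecMulVec (fun r : Orb Λ × Orb Λ => γ r.1 r.2) (star fun r : Orb Λ × Orb Λ => γ r.1 r.2) *ᵥ
          (Pi.single (orb p 0, orb p 0) (1 : ℂ) + Pi.single (orb p 1, orb p 1) 1)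
      = (γ (orb p 0) (orb p 0) + γ (orb p 1) (orb p 1)) *
          star (γ (orb p 0) (orb p 0) + γ (orb p 1) (orb p 1)) := by
  classical
  rw [Literature.LinearAlgebra.Matrix.star_dotProduct_mulVec_single_add_single]
  simp only [vecMulVec_apply, Pi.star_apply, star_one, one_mul, star_add]
  ring

/-- On the DQG-feasible set the site occupation `n_p = γ_{p↑,p↑} + γ_{p↓,p↓}` is REAL
(`star n_p = n_p`; Hermitian `γ`). [folklore] -/
theorem star_occupation_eq (hf : IsDQGFeasible N γ Γ) (p : Λ) :
    star (γ (orb p 0) (orb p 0) + γ (orb p 1) (orb p 1))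
      = γ (orb p 0) (orb p 0) + γ (orb p 1) (orb p 1) := by
  rw [star_add, hf.herm_one.apply, hf.herm_one.apply]

/-- **THE CHARGE IDENTITY.** On the DQG-feasible set, for every site `p`:
`w_p† Ĝ w_p = d_p + e_p − (n_p − 1)²` with `Ĝ = gMap γ Γ − γγ†`, `d_p = Γ_{(p↑,p↓),(p↑,p↓)}`,
`e_p = ²Q_{(p↑,p↓),(p↑,p↓)} = 1 − n_p + d_p`, `n_p = γ_{p↑,p↑} + γ_{p↓,p↓}` (for states: the charge
VARIANCE `⟨n̂_p²⟩ − ⟨n̂_p⟩² = ⟨(n̂_p − 1)²⟩ − (⟨n̂_p⟩ − 1)²` and `(n̂_p − 1)² = n̂_{p↑}n̂_{p↓} + (1 − n̂_{p↑})(1 − n̂_{p↓})`).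
The words' "`w_iᵀĜw_i = d_i + e_i`" is the case `n_p = 1`. [folklore] -/
theorem chargeForm_gHat_eq (hf : IsDQGFeasible N γ Γ) (p : Λ) :
    star (Pi.single (orb p 0, orb p 0) (1 : ℂ) + Pi.single (orb p 1, orb p 1) 1) ⬝ᵥ
        (gMap γ Γ - vecMulVec (fun r : Orb Λ × Orb Λ => γ r.1 r.2)
          (star fun r : Orb Λ × Orb Λ => γ r.1 r.2)) *ᵥ
          (Pi.single (orb p 0, orb p 0) (1 : ℂ) + Pi.single (orb p 1, orb p 1) 1)
      = Γ (orb p 0, orb p 1) (orb p 0, orb p 1) + qMap γ Γ (orb p 0, orb p 1) (orb p 0, orb p 1)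
          - (γ (orb p 0) (orb p 0) + γ (orb p 1) (orb p 1) - 1) ^ 2 := by
  have h01 : (0 : Fin 2) ≠ 1 := by decide
  rw [sub_mulVec, dotProduct_sub, chargeForm_gMap_eq hf.swap_fst hf.swap_snd,
    chargeForm_vecMulVec_eq, star_occupation_eq hf, qMap_apply_sameSite γ Γ p h01]
  ring

/-- The real part of the charge identity: `Re w_p†Ĝw_p = Re d_p + Re e_p − (Re n_p − 1)²`
(`n_p` is real). [folklore] -/
theorem chargeForm_gHat_re_eq (hf : IsDQGFeasible N γ Γ) (p : Λ) :
    (star (Pi.single (orb p 0, orb p 0) (1 : ℂ) + Pi.single (orb p 1, orb p 1) 1) ⬝ᵥ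
        (gMap γ Γ - vecMulVec (fun r : Orb Λ × Orb Λ => γ r.1 r.2)
          (star fun r : Orb Λ × Orb Λ => γ r.1 r.2)) *ᵥ
          (Pi.single (orb p 0, orb p 0) (1 : ℂ) + Pi.single (orb p 1, orb p 1) 1)).re
      = (Γ (orb p 0, orb p 1) (orb p 0, orb p 1)).re
          + (qMap γ Γ (orb p 0, orb p 1) (orb p 0, orb p 1)).re
          - ((γ (orb p 0) (orb p 0)).re + (γ (orb p 1) (orb p 1)).re - 1) ^ 2 := by
  rw [chargeForm_gHat_eq hf]
  have h0 : (γ (orb p 0) (orb p 0)).im = 0 := (hf.diag_nonneg (orb p 0)).2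
  have h1 : (γ (orb p 1) (orb p 1)).im = 0 := (hf.diag_nonneg (orb p 1)).2
  simp only [Complex.sub_re, Complex.add_re, sq, Complex.mul_re, Complex.sub_im, Complex.add_im,
    Complex.one_re, Complex.one_im, h0, h1]
  ring

/-- **`0 ≤ Re w_p†Ĝw_p ≤ Re d_p + Re e_p`** on the DQG-feasible set (`Ĝ ⪰ 0`,
`gMap_sub_vecMulVec_posSemidef`; the subtracted square is non-negative) — the charge form at a
site is controlled by that site's doublon and holon weights. [folklore] -/
theorem chargeForm_gHat_re_mem (hf : IsDQGFeasible N γ Γ) (p : Λ) :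
    0 ≤ (star (Pi.single (orb p 0, orb p 0) (1 : ℂ) + Pi.single (orb p 1, orb p 1) 1) ⬝ᵥ
        (gMap γ Γ - vecMulVec (fun r : Orb Λ × Orb Λ => γ r.1 r.2)
          (star fun r : Orb Λ × Orb Λ => γ r.1 r.2)) *ᵥ
          (Pi.single (orb p 0, orb p 0) (1 : ℂ) + Pi.single (orb p 1, orb p 1) 1)).re ∧
    (star (Pi.single (orb p 0, orb p 0) (1 : ℂ) + Pi.single (orb p 1, orb p 1) 1) ⬝ᵥ
        (gMap γ Γ - vecMulVec (fun r : Orb Λ × Orb Λ => γ r.1 r.2)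
          (star fun r : Orb Λ × Orb Λ => γ r.1 r.2)) *ᵥ
          (Pi.single (orb p 0, orb p 0) (1 : ℂ) + Pi.single (orb p 1, orb p 1) 1)).re
      ≤ (Γ (orb p 0, orb p 1) (orb p 0, orb p 1)).re
          + (qMap γ Γ (orb p 0, orb p 1) (orb p 0, orb p 1)).re := by
  refine ⟨(Complex.nonneg_iff.1
    ((gMap_sub_vecMulVec_posSemidef γ Γ hf).dotProduct_mulVec_nonneg _)).1, ?_⟩
  rw [chargeForm_gHat_re_eq hf]
  nlinarith [sq_nonneg ((γ (orb p 0) (orb p 0)).re + (γ (orb p 1) (orb p 1)).re - 1)]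

/-- **LOCAL HALF FILLING IS FORCED BY `Ĝ ⪰ 0`**: on the DQG-feasible set every site obeys
`(Re n_p − 1)² ≤ Re d_p + Re e_p` — a site whose doublon AND holon weights are `O(ε²)` is singly
occupied up to `O(ε)`, for every feasible pair, not only for states (no translation invariance, no
sector row used). [folklore] -/
theorem sq_occupation_sub_one_le (hf : IsDQGFeasible N γ Γ) (p : Λ) :
    ((γ (orb p 0) (orb p 0)).re + (γ (orb p 1) (orb p 1)).re - 1) ^ 2
      ≤ (Γ (orb p 0, orb p 1) (orb p 0, orb p 1)).re
          + (qMap γ Γ (orb p 0, orb p 1) (orb p 0, orb p 1)).re := by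
  have h := (chargeForm_gHat_re_mem hf p).1
  rw [chargeForm_gHat_re_eq hf] at h
  linarith

/-- **CHARGE-MOMENT ENTRIES (the words' `u_i`).** `Ĝ`-Cauchy–Schwarz against the charge vector:
for every vector `x` and site `p`, `‖x† Ĝ w_p‖ ≤ √(Re x†Ĝx) · √(Re d_p + Re e_p)` — every entry of
`Ĝ` against a site's charge vector is as small as the square root of that site's doublon-plus-holon
weight (`O(ε)`), uniformly in the (bounded) test vector. [folklore] -/
theorem norm_form_gHat_charge_le (hf : IsDQGFeasible N γ Γ) (x : Orb Λ × Orb Λ → ℂ) (p : Λ) :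
    ‖star x ⬝ᵥ (gMap γ Γ - vecMulVec (fun r : Orb Λ × Orb Λ => γ r.1 r.2)
          (star fun r : Orb Λ × Orb Λ => γ r.1 r.2)) *ᵥ
          (Pi.single (orb p 0, orb p 0) (1 : ℂ) + Pi.single (orb p 1, orb p 1) 1)‖
      ≤ Real.sqrt (star x ⬝ᵥ (gMap γ Γ - vecMulVec (fun r : Orb Λ × Orb Λ => γ r.1 r.2)
          (star fun r : Orb Λ × Orb Λ => γ r.1 r.2)) *ᵥ x).re *
        Real.sqrt ((Γ (orb p 0, orb p 1) (orb p 0, orb p 1)).re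
          + (qMap γ Γ (orb p 0, orb p 1) (orb p 0, orb p 1)).re) := by
  have hG := gMap_sub_vecMulVec_posSemidef γ Γ hf
  refine (norm_form_le_sqrt_of_posSemidef hG x _).trans ?_
  rw [Real.sqrt_mul (Complex.nonneg_iff.1 (hG.dotProduct_mulVec_nonneg x)).1]
  exact mul_le_mul_of_nonneg_left (Real.sqrt_le_sqrt (chargeForm_gHat_re_mem hf p).2)
    (Real.sqrt_nonneg _)

/-- **CONNECTED DENSITY–DENSITY ENTRIES (the words' `κ_{ii′}`).** For sites `p, q`:
`‖w_p† Ĝ w_q‖ ≤ √(Re d_p + Re e_p) · √(Re d_q + Re e_q)` — the connected charge–charge moments of a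
feasible pair are `O(ε²)` when both sites' doublon and holon weights are. [folklore] -/
theorem norm_chargeForm_gHat_le (hf : IsDQGFeasible N γ Γ) (p q : Λ) :
    ‖star (Pi.single (orb p 0, orb p 0) (1 : ℂ) + Pi.single (orb p 1, orb p 1) 1) ⬝ᵥ
        (gMap γ Γ - vecMulVec (fun r : Orb Λ × Orb Λ => γ r.1 r.2)
          (star fun r : Orb Λ × Orb Λ => γ r.1 r.2)) *ᵥ
          (Pi.single (orb q 0, orb q 0) (1 : ℂ) + Pi.single (orb q 1, orb q 1) 1)‖
      ≤ Real.sqrt ((Γ (orb p 0, orb p 1) (orb p 0, orb p 1)).re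
          + (qMap γ Γ (orb p 0, orb p 1) (orb p 0, orb p 1)).re) *
        Real.sqrt ((Γ (orb q 0, orb q 1) (orb q 0, orb q 1)).re
          + (qMap γ Γ (orb q 0, orb q 1) (orb q 0, orb q 1)).re) := by
  refine (norm_form_gHat_charge_le hf _ q).trans ?_
  exact mul_le_mul_of_nonneg_right (Real.sqrt_le_sqrt (chargeForm_gHat_re_mem hf p).2)
    (Real.sqrt_nonneg _)

end Charge

end StrongCouplingEntry

end Summit.Ventures.CertifiedQuantumChemistry
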